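import Mathlib
import Summits.AnomalousDissipation.AnomalousDissipation.Theorems.SoloBlindCubicInnerFamily

/-!
# Finite-`n` contact layers and the selection of the extreme inner solution

Kernel of solo-blind paper §24.18.  At finite `n` (cross-leaf coupling `ε² A''`, `ε ∝ 1/n`) the
scaled steady envelope problem near threshold is, in the pure third-order model,

  `q‴ = 1 - s² + ε² (√q)''/√q`,  `q = A² > 0` on `ℝ`, `q → 0` at `±∞`,

whose `ε = 0` limit on `{q > 0}` is the inner free-boundary problem `Q‴ = 1 - s²` solved by the
one-parameter family `Q_{a,b}` of `SoloBlindCubicInnerFamily`.  The highest derivative acts on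
`q = A²`, so where `A` is small there is a FAST mode of rate `ε²/(2q) > 0`, always growing to the
right: from `s = -∞` a two-parameter family of admissible solutions leaves, into `s = +∞` only a
one-parameter family arrives, and solutions are ISOLATED — finite `n` selects members of the family.
Which member is decided in the contact layers.  At the left contact `a` the layer has width `ε²`,
`q = ε⁴ φ(ξ)`, and `φ` solves the autonomous LAYER EQUATION

  `φ² φ‴ = φ φ''/2 - (φ')²/4`     (equivalently `(A²)‴ = A''/A`, `A = √φ`),

which this file studies algebraically: (i) the `A`-form and the `φ`-form agree
(`layerResidual_eq_A_form`); (ii) its far-field states are exactly the perfect squares — a quadratic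
`γξ² + αξ + β` solves it iff `α² = 4γβ` (`layerResidual_quadratic`), so the interior C¹ contact
persists with an `O(ε⁴)` offset; (iii) the linearisation at a constant state `φ∞` has rates
`{0, 0, 1/(2φ∞)}` (`layerResidual_linearisation`, `layer_rates`) — the fast mode; (iv) the equation is
invariant under `(φ, ξ) ↦ (λφ, λξ)` (`layerResidual_scale`), so one universal profile serves all
contacts; (v) in the invariants `P = φ'`, `R = φ φ''` it reduces to the planar equation
`dR/dP = P + 1/2 - P²/(4R)` (`layer_phasePlane`), with the perfect squares as the invariant
parabola `R = P²/2` (`layer_parabola_slope`) and the excess `g = R - P²/2` obeying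
`dg/dP = g/(P² + 2g)` (`layer_excess_slope`): the left-contact connection leaves the constant state
along `R = P/2`, stays strictly above the parabola and converges to it (`Γ > 0`).
At the right contact `b` no such autonomous connection exists (a trajectory with `R > 0` has `P`
increasing and cannot enter `P = R = 0` from `P < 0` except along the parabola, i.e. with `φ → 0`),
so the layer there has width `ε` and `q = O(ε³)`, which forces the contact curvature `Q''(b)` of the
interior solution to vanish to leading order.  The algebraic content of the resulting SELECTION
PRINCIPLE is `cubicFamily_C2_contact_iff`: on the admissible arc the only compactly supported member
(`a < b`) with a C² contact at `b` is the extreme member `(a, b) = (-√6, 2√6/3)`.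
All statements are identities / equivalences over `ℝ`; the matched-asymptotics argument itself is
in the paper, not here.
-/

namespace Summit.AnomalousDissipation.AnomalousDissipation.Theorems

/-- The layer-equation residual on a 3-jet `(φ, φ', φ'', φ‴)`: `φ² φ‴ - φ φ''/2 + (φ')²/4`. -/
noncomputable def layerResidual (p0 p1 p2 p3 : ℝ) : ℝ :=
  p0 ^ 2 * p3 - p0 * p2 / 2 + p1 ^ 2 / 4

/-- `φ`-form versus `A`-form: if `φ = A²` (jets related by the Leibniz rule) then
`φ²φ‴ - φφ''/2 + φ'²/4 = A³ · (2A²A‴ + 6AA'A'' - A'')`, i.e. the layer equation is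
`(A²)‴ = A''/A` multiplied by `A⁴`. -/
theorem layerResidual_eq_A_form (A0 A1 A2 A3 : ℝ) :
    layerResidual (A0 ^ 2) (2 * A0 * A1) (2 * (A1 ^ 2 + A0 * A2)) (2 * (A0 * A3 + 3 * A1 * A2))
      = A0 ^ 3 * (2 * A0 ^ 2 * A3 + 6 * A0 * A1 * A2 - A2) := by
  unfold layerResidual
  ring

/-- Far field: on the jet of a quadratic `φ(ξ) = γξ² + αξ + β` the residual is the CONSTANT
`(α² - 4γβ)/4` (independent of `ξ`). -/
theorem layerResidual_quadratic (γ α β ξ : ℝ) :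
    layerResidual (γ * ξ ^ 2 + α * ξ + β) (2 * γ * ξ + α) (2 * γ) 0 = (α ^ 2 - 4 * γ * β) / 4 := by
  unfold layerResidual
  ring

/-- Hence a quadratic solves the layer equation iff its discriminant vanishes, i.e. (for `γ > 0`)
iff it is a perfect square `γ (ξ - ξ₀)²`: the far-field states of the layer are exactly the
interior C¹ contacts. -/
theorem layer_quadratic_solves_iff (γ α β : ℝ) :
    (∀ ξ : ℝ, layerResidual (γ * ξ ^ 2 + α * ξ + β) (2 * γ * ξ + α) (2 * γ) 0 = 0)
      ↔ α ^ 2 = 4 * γ * β := by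
  constructor
  · intro h
    have h0 := h 0
    rw [layerResidual_quadratic] at h0
    linarith
  · intro h ξ
    rw [layerResidual_quadratic, h]
    ring

/-- A perfect square `γ (ξ - ξ₀)²` (jet `(γ(ξ-ξ₀)², 2γ(ξ-ξ₀), 2γ, 0)`) solves the layer equation. -/
theorem layer_perfectSquare_solves (γ ξ₀ ξ : ℝ) :
    layerResidual (γ * (ξ - ξ₀) ^ 2) (2 * γ * (ξ - ξ₀)) (2 * γ) 0 = 0 := by
  unfold layerResidual
  ring

/-- Linearisation at a constant state: on the jet of `φ∞ + δ E` with `E = e^{rξ}`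
(jet `(φ∞ + δE, δ r E, δ r² E, δ r³ E)`) the residual is
`δE·φ∞ r²(φ∞ r - 1/2) + δ²E²·r²(2φ∞ r - 1/4) + δ³E³·r³` exactly. -/
theorem layerResidual_linearisation (φinf δ E r : ℝ) :
    layerResidual (φinf + δ * E) (δ * r * E) (δ * r ^ 2 * E) (δ * r ^ 3 * E)
      = δ * E * (φinf * r ^ 2 * (φinf * r - 1 / 2))
        + δ ^ 2 * E ^ 2 * (r ^ 2 * (2 * φinf * r - 1 / 4)) + δ ^ 3 * E ^ 3 * r ^ 3 := by
  unfold layerResidual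
  ring

/-- The linear rates at a constant state `φ∞ ≠ 0` are `r = 0` (double: the constant and the linear
mode) and the FAST rate `r = 1/(2φ∞) > 0`: the mode that always grows towards increasing `s`. -/
theorem layer_rates (φinf r : ℝ) (hφ : φinf ≠ 0) :
    φinf * r ^ 2 * (φinf * r - 1 / 2) = 0 ↔ r = 0 ∨ r = 1 / (2 * φinf) := by
  constructor
  · intro h
    rcases mul_eq_zero.mp h with h1 | h2
    · rcases mul_eq_zero.mp h1 with h3 | h4
      · exact absurd h3 hφ
      · left; exact pow_eq_zero_iff (two_ne_zero) |>.mp h4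
    · right
      field_simp
      linarith
  · rintro (h | h)
    · subst h; ring
    · subst h; field_simp; ring

/-- Scale invariance: the jet of `φ_λ(ξ) = λ φ(ξ/λ)` at `ξ` is `(λp₀, p₁, p₂/λ, p₃/λ²)` where
`(p₀,p₁,p₂,p₃)` is the jet of `φ` at `ξ/λ`, and the residual is unchanged.  One universal layer
profile therefore serves every contact (the constant state can be normalised to `φ∞ = 1`). -/
theorem layerResidual_scale (l p0 p1 p2 p3 : ℝ) (hl : l ≠ 0) :
    layerResidual (l * p0) p1 (p2 / l) (p3 / l ^ 2) = layerResidual p0 p1 p2 p3 := by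
  unfold layerResidual
  field_simp

/-- Phase-plane reduction, polynomial form: along a solution jet,
`4φ (φ'φ'' + φφ‴) = 4φφ'' (φ' + 1/2) - φ'²`. -/
theorem layer_phasePlane_mul (p0 p1 p2 p3 : ℝ) (hsol : layerResidual p0 p1 p2 p3 = 0) :
    4 * p0 * (p1 * p2 + p0 * p3) = 4 * p0 * p2 * (p1 + 1 / 2) - p1 ^ 2 := by
  unfold layerResidual at hsol
  linear_combination 4 * hsol

/-- Phase-plane reduction.  With the scale-invariant quantities `P = φ'`, `R = φ φ''` one has along
a solution `dP/dξ = φ''`, `dR/dξ = φ'φ'' + φφ‴`, hence (where `φ, φ'' ≠ 0`)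
`dR/dP = (φ'φ'' + φφ‴)/φ'' = P + 1/2 - P²/(4R)`. -/
theorem layer_phasePlane (p0 p1 p2 p3 : ℝ) (h0 : p0 ≠ 0) (h2 : p2 ≠ 0)
    (hsol : layerResidual p0 p1 p2 p3 = 0) :
    (p1 * p2 + p0 * p3) / p2 = p1 + 1 / 2 - p1 ^ 2 / (4 * (p0 * p2)) := by
  unfold layerResidual at hsol
  have h4 : (4 : ℝ) * (p0 * p2) ≠ 0 := mul_ne_zero (by norm_num) (mul_ne_zero h0 h2)
  rw [eq_sub_iff_add_eq, div_add_div _ _ h2 h4, div_eq_iff (mul_ne_zero h2 h4)]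
  linear_combination (4 * p2) * hsol

/-- The perfect squares are the invariant parabola `R = P²/2` of the planar equation: on it the
slope `P + 1/2 - P²/(4R)` equals `P = d(P²/2)/dP`. -/
theorem layer_parabola_slope (P : ℝ) (hP : P ≠ 0) :
    P + 1 / 2 - P ^ 2 / (4 * (P ^ 2 / 2)) = P := by
  field_simp
  ring

/-- On a perfect-square jet (`p₃ = 0`, `p₁² = 2 p₀ p₂`, which is `α² = 4γβ` rewritten) one has
`R = P²/2`. -/
theorem layer_parabola_of_square (γ ξ₀ ξ : ℝ) :
    (γ * (ξ - ξ₀) ^ 2) * (2 * γ) = (2 * γ * (ξ - ξ₀)) ^ 2 / 2 := by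
  ring

/-- The excess over the parabola, `g = R - P²/2`, obeys `dg/dP = dR/dP - P = g/(P² + 2g)`:
it keeps its sign and, for `g > 0`, increases with `P` while `log g` converges as `P → ∞`
(`dg/dP ≤ g/P²`).  The left-contact connection leaves the constant state along `R = P/2`, i.e. with
`g > 0` for small `P > 0`, so it stays strictly above the parabola: the contact offset `Γ > 0`. -/
theorem layer_excess_slope (P g : ℝ) (hR : P ^ 2 / 2 + g ≠ 0) :
    (P + 1 / 2 - P ^ 2 / (4 * (P ^ 2 / 2 + g))) - P = g / (P ^ 2 + 2 * g) := by
  have h2 : P ^ 2 + 2 * g ≠ 0 := by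
    intro h; apply hR; linarith
  field_simp
  ring

/-- Along the unstable branch `R = P/2` leaving the constant state the slope exceeds `1/2` by `P/2`:
trajectories starting on it move above the line for `P > 0`. -/
theorem layer_unstableBranch_slope (P : ℝ) (_hP : P ≠ 0) :
    P + 1 / 2 - P ^ 2 / (4 * (P / 2)) = 1 / 2 + P / 2 := by
  field_simp
  ring

/-- For `R > 0` the planar vector field has `dP/dξ = φ'' = R/φ` of the sign of `φ`: with `φ > 0`,
`P` is increasing along every solution arc on which `R > 0` (used at the right contact: a trajectory
coming from the interior, `P → -∞`, can only reach `P = 0` with `R > 0` throughout). -/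
theorem layer_P_increasing (φ R : ℝ) (hφ : 0 < φ) (hR : 0 < R) : 0 < R / φ :=
  div_pos hR hφ

/-- SELECTION PRINCIPLE (algebraic content).  On the ellipse `3a² + 4ab + 3b² = 10` with `a < b`
(compact support `[a, b]`), the contact at `b` is C² — `Q''(b) = 0` — iff `(a, b)` is the extreme
member `(-√6, 2√6/3)`.  (Finite `n` forces `Q''(b) = O(ε)` at the contact towards which the fast
mode grows, hence selects this member to leading order.) -/
theorem cubicFamily_C2_contact_iff (a b : ℝ) (hE : 3 * a ^ 2 + 4 * a * b + 3 * b ^ 2 = 10)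
    (hab : a < b) :
    cubicFamilyQ2 a b b = 0 ↔ (a = -Real.sqrt 6 ∧ b = 2 * Real.sqrt 6 / 3) := by
  have h6 : Real.sqrt 6 ^ 2 = 6 := Real.sq_sqrt (by norm_num)
  have hs6 : 0 < Real.sqrt 6 := Real.sqrt_pos.mpr (by norm_num)
  rw [(cubicFamilyQ_contact_right a b).2.2]
  constructor
  · intro h
    have hne : (a - b) ^ 2 ≠ 0 := by
      have : a - b ≠ 0 := sub_ne_zero.mpr (ne_of_lt hab)
      positivity
    have h23 : 2 * a + 3 * b = 0 := by
      have hm : (a - b) ^ 2 * (-(2 * a + 3 * b)) = 0 := by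
        have := h
        field_simp at this
        linarith
      rcases mul_eq_zero.mp hm with h1 | h2
      · exact absurd h1 hne
      · linarith
    have ha : a = -(3 / 2) * b := by linarith
    have hb2 : b ^ 2 = 8 / 3 := by
      rw [ha] at hE
      nlinarith
    have hbpos : 0 < b := by
      rcases lt_or_ge 0 b with h | h
      · exact h
      · exfalso
        have : a ≤ b := le_of_lt hab
        rw [ha] at this
        nlinarith
    have hc2 : (2 * Real.sqrt 6 / 3) ^ 2 = 8 / 3 := by nlinarith [h6]
    have hprod : (b - 2 * Real.sqrt 6 / 3) * (b + 2 * Real.sqrt 6 / 3) = 0 := by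
      nlinarith [hb2, hc2]
    rcases mul_eq_zero.mp hprod with h1 | h2
    · have hb : b = 2 * Real.sqrt 6 / 3 := by linarith
      refine ⟨?_, hb⟩
      rw [ha, hb]; ring
    · exfalso
      have : b = -(2 * Real.sqrt 6 / 3) := by linarith
      rw [this] at hbpos
      linarith
  · rintro ⟨ha, hb⟩
    rw [ha, hb]
    ring

/-- The mirror point `(a, b) = (√6, -2√6/3)` also satisfies `2a + 3b = 0` on the ellipse, but has
`a > b`: its profile `-(s-a)²(s-b)³/60` is nonnegative on `s ≤ b` with NO second contact
(unbounded support), so it is not a pattern — the extreme member is the unique compactly supported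
C²-contact solution. -/
theorem cubicFamily_mirror_point :
    3 * (Real.sqrt 6) ^ 2 + 4 * (Real.sqrt 6) * (-(2 * Real.sqrt 6 / 3))
        + 3 * (-(2 * Real.sqrt 6 / 3)) ^ 2 = 10 ∧
      2 * Real.sqrt 6 + 3 * (-(2 * Real.sqrt 6 / 3)) = 0 ∧
      -(2 * Real.sqrt 6 / 3) < Real.sqrt 6 := by
  have h6 : Real.sqrt 6 ^ 2 = 6 := Real.sq_sqrt (by norm_num)
  have hs6 : 0 < Real.sqrt 6 := Real.sqrt_pos.mpr (by norm_num)
  refine ⟨?_, ?_, ?_⟩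
  · linear_combination (5/3 : ℝ) * h6
  · ring
  · linarith

/-- Leading-order data of the selected pattern: support `[-√6, 2√6/3]` (length `5√6/3`), C¹ contact
curvature at `a`: `Q''(a) = (a-b)²(-(3a+2b))/30 = 25√6/27` (`= (u+v)³/30` of
`SoloBlindCubicInnerSolution`), and `Q''(b) = 0`. -/
theorem cubicFamily_selected_data :
    cubicFamilyQ2 (-Real.sqrt 6) (2 * Real.sqrt 6 / 3) (2 * Real.sqrt 6 / 3) = 0 ∧
    cubicFamilyQ2 (-Real.sqrt 6) (2 * Real.sqrt 6 / 3) (-Real.sqrt 6) = 25 * Real.sqrt 6 / 27 ∧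
    2 * Real.sqrt 6 / 3 - (-Real.sqrt 6) = 5 * Real.sqrt 6 / 3 := by
  have h6 : Real.sqrt 6 ^ 2 = 6 := Real.sq_sqrt (by norm_num)
  have h63 : Real.sqrt 6 ^ 3 = 6 * Real.sqrt 6 := by
    rw [pow_succ, h6]
  refine ⟨?_, ?_, ?_⟩
  · rw [(cubicFamilyQ_contact_right _ _).2.2]; ring
  · rw [(cubicFamilyQ_contact_left _ _).2.2]
    have : (-Real.sqrt 6 - 2 * Real.sqrt 6 / 3) ^ 2 * (-(3 * -Real.sqrt 6 + 2 * (2 * Real.sqrt 6 / 3))) / 30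
        = (25 * 5 / (9 * 3 * 30)) * Real.sqrt 6 ^ 3 := by ring
    rw [this, h63]; ring
  · ring

end Summit.AnomalousDissipation.AnomalousDissipation.Theorems
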